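import Mathlib
import Literature.Computability.AlgebraicComplexity.JointCircuits
import Literature.Computability.AlgebraicComplexity.FastSeriesCircuits
import HarnessLib

/-!
# All elementary symmetric polynomials in `O(n log² n)` gates (Strassen's bound, via the FFT product tree)

Topic `Computability/AlgebraicComplexity`, namespace `Literature.Computability.AlgebraicComplexity`.
Everything PROVED; one bookkeeping definition (`zeta2`, the `2`-power roots of unity in `ℂ`), no named
facts.

`ElementarySymmetricCircuit.lean` gives the dynamic-programming bound `L(e_k) ≤ 2(k+1)n` for ONE
elementary symmetric polynomial over any commutative semiring.  Over `ℂ` (indeed over any commutative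
ring containing the `2`-power roots of unity and `1/2`) ALL of `e_0, …, e_n` together cost
`O(n log² n)` gates — they are the coefficients of `∏_l (1 + x_l s)`, computed by the FFT product tree
(von zur Gathen–Gerhard §10.1, Lemma 10.4; classically Strassen 1973 / Bürgisser–Clausen–Shokrollahi
§2): this file instantiates `jointlyComputed_prod_linear` (`FastSeriesCircuits.lean`):

* `coeff_prod_C_mul_X_add_one` : `[s^j] ∏_l (a_l s + 1) = Σ_{|t| = j} ∏_{l ∈ t} a_l`; hence
  `coeff_prod_linear_eq_esymm` : `[s^j] ∏_l (x_l s + 1) = e_j(x)`;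
* `jointlyComputed_esymm` : `e_0, …, e_n` are jointly computed within `prodTreeCost K ≤ 16 K² 2^K`
  gates for any `K` with `n ≤ 2^K` (roots of unity and `(2^κ)⁻¹` supplied as hypotheses);
* `zeta2`, `zeta2_pow` and `complexity_esymm_le_of_le_two_pow` : over `ℂ`, for every `j`,
  `complexity (esymm (Fin n) ℂ j) ≤ 16 K² 2^K` whenever `n ≤ 2^K` (so `O(n log² n)` with
  `K = ⌈log₂ n⌉`).

## References

* J. von zur Gathen, J. Gerhard, *Modern Computer Algebra*, CUP (3rd ed. 2013), §10.1, Algorithm 10.3 /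
  Lemma 10.4. [GathenGerhard2013]
* [Burgisser2000] P. Bürgisser, *Completeness and Reduction in Algebraic Complexity Theory*, Springer
  2000, Def. 2.1 (the circuit model).
-/

noncomputable section

open MvPolynomial

namespace Literature.Computability.AlgebraicComplexity

section ElementarySymmetricFFT

universe uu vv ww

variable {k : Type uu} [CommRing k]

open _root_.Finset

/-- **`[s^j] ∏_l (a_l s + 1) = Σ_{|t| = j} ∏_{l ∈ t} a_l`** over any commutative semiring.
[cite: GathenGerhard2013, §10.1 Lemma 10.4] -/
theorem coeff_prod_C_mul_X_add_one {S : Type*} [CommSemiring S] {n : ℕ} (a : Fin n → S) (j : ℕ) :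
    (∏ l, (Polynomial.C (a l) * Polynomial.X + Polynomial.C 1)).coeff j =
      ∑ t ∈ powersetCard j univ, ∏ l ∈ t, a l := by
  classical
  have hprod : (∏ l, (Polynomial.C (a l) * Polynomial.X + Polynomial.C 1)) =
      ∑ t ∈ (univ : Finset (Fin n)).powerset, Polynomial.C (∏ l ∈ t, a l) * Polynomial.X ^ t.card := by
    rw [prod_add]
    refine sum_congr rfl fun t _ => ?_
    rw [Polynomial.C_1, prod_const_one, mul_one, prod_mul_distrib, map_prod, prod_const]
  rw [hprod, Polynomial.finsetSum_coeff]
  simp only [Polynomial.coeff_C_mul_X_pow]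
  rw [← sum_filter]
  refine sum_congr ?_ fun t _ => rfl
  ext t
  simp [mem_powersetCard, eq_comm]

/-- **`[s^j] ∏_l (x_l s + 1) = e_j(x_1, …, x_n)`** (the generating polynomial of the elementary
symmetric polynomials). [cite: GathenGerhard2013, §10.1 Lemma 10.4] -/
theorem coeff_prod_linear_eq_esymm (n j : ℕ) :
    (∏ l : Fin n, (Polynomial.C (X l : MvPolynomial (Fin n) k) * Polynomial.X + Polynomial.C 1)).coeff j
      = esymm (Fin n) k j := by
  rw [coeff_prod_C_mul_X_add_one]
  rfl

/-- **All elementary symmetric polynomials by the FFT product tree**: `e_0, …, e_n` of `n ≤ 2^K`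
variables are jointly computed within `prodTreeCost K ≤ 16 K² 2^K` gates, given scalars `ζ κ` with
`(ζ κ)^{2^{κ-1}} = −1` and `tinv κ` with `2^κ · tinv κ = 1`. [cite: GathenGerhard2013, §10.1 Lemma 10.4] -/
theorem jointlyComputed_esymm (ζ tinv : ℕ → k)
    (hζ : ∀ κ, κ ≠ 0 → ζ κ ^ 2 ^ (κ - 1) = -1) (ht : ∀ κ, (2 ^ κ : k) * tinv κ = 1)
    {n K : ℕ} (hK : n ≤ 2 ^ K) :
    JointlyComputed (fun j : Fin (n + 1) => esymm (Fin n) k (j : ℕ)) (prodTreeCost K) := by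
  -- inputs: the variables and the constant `1`
  let u : Fin n ⊕ Unit → MvPolynomial (Fin n) k := Sum.elim (fun l => X l) (fun _ => 1)
  have hu : JointlyComputed u 0 := jointlyComputed_of_inputs u (by
    rintro (l | x)
    · exact Or.inl ⟨l, rfl⟩
    · exact Or.inr ⟨1, by simp [u]⟩)
  have h := jointlyComputed_prod_linear ζ tinv hζ ht hu hK (fun _ => (1 : MvPolynomial (Fin n) k))
    (fun l => X l) (fun _ => Sum.inr ()) (fun l => Sum.inl l) (fun _ => rfl) (fun _ => rfl)
  rw [Nat.zero_add] at h
  refine h.of_mem _ fun j => Or.inl ⟨Sum.inr j, ?_⟩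
  simp only [Sum.elim_inr]
  exact (coeff_prod_linear_eq_esymm n j).symm

/-- The `2`-power roots of unity in `ℂ`: `zeta2 κ = exp(π i / 2^{κ-1}) = e^{2πi/2^κ}` (GG §8.2).
[cite: GathenGerhard2013, §8.2 (primitive roots of unity)] -/
def zeta2 (κ : ℕ) : ℂ := Complex.exp (Real.pi * Complex.I / (2 : ℂ) ^ (κ - 1))

/-- `(zeta2 κ)^{2^{κ-1}} = −1` (the primitive `2^κ`-th root of unity `e^{2πi/2^κ}` has order `2^κ`,
so its `2^{κ-1}`-th power is `−1`; GG §8.2). [cite: GathenGerhard2013, §8.2 (primitive roots of unity)] -/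
theorem zeta2_pow (κ : ℕ) (_hκ : κ ≠ 0) : zeta2 κ ^ 2 ^ (κ - 1) = -1 := by
  rw [zeta2, ← Complex.exp_nat_mul]
  have h2 : ((2 : ℂ)) ^ (κ - 1) ≠ 0 := pow_ne_zero _ two_ne_zero
  rw [show ((2 ^ (κ - 1) : ℕ) : ℂ) * (Real.pi * Complex.I / (2 : ℂ) ^ (κ - 1)) =
    Real.pi * Complex.I by push_cast; field_simp]
  exact Complex.exp_pi_mul_I

/-- **Strassen's bound over `ℂ`**: `complexity (e_j(x_1, …, x_n)) ≤ 16 K² 2^K` whenever `n ≤ 2^K`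
(all `e_j`, `j ≤ n`, from ONE circuit; `e_j = 0` for `j > n`). [cite: GathenGerhard2013, §10.1 Lemma 10.4] -/
theorem complexity_esymm_le_of_le_two_pow {n K : ℕ} (hK : n ≤ 2 ^ K) (j : ℕ) :
    complexity (esymm (Fin n) ℂ j) ≤ 16 * K ^ 2 * 2 ^ K := by
  by_cases hj : j ≤ n
  · have h := jointlyComputed_esymm zeta2 (fun κ => ((2 : ℂ) ^ κ)⁻¹) zeta2_pow
      (fun κ => mul_inv_cancel₀ (pow_ne_zero _ two_ne_zero)) hK
    exact (h.complexity_le ⟨j, by omega⟩).trans (prodTreeCost_le K)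
  · have h0 : esymm (Fin n) ℂ j = 0 := by
      rw [esymm, powersetCard_eq_empty.2 (by simp; omega), sum_empty]
    rw [h0, show (0 : MvPolynomial (Fin n) ℂ) = C 0 from (map_zero C).symm, complexity_C_holds]
    exact Nat.zero_le _

end ElementarySymmetricFFT

end Literature.Computability.AlgebraicComplexity

end
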